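import Mathlib
import HarnessLib
import Summits.Ventures.LatticeQCDFlow.Exactness.FlowPushforward
import Summits.Ventures.LatticeQCDFlow.Exactness.KickAngleJacobian
import Summits.Ventures.LatticeQCDFlow.Exactness.SphereGeodesicKick
import Summits.Ventures.LatticeQCDFlow.Exactness.SphereAxisCoordinates
import Summits.Ventures.LatticeQCDFlow.Exactness.SphereAxisDisintegration

/-!
# Engel–Schaefer eq. (18) on the sphere itself: the printed per-site factor is an exact `HasJacobian` of the leading-order kick against the surface measure of `S^{n+1}`

HONEST FRAMING: exact (Metropolis-corrected) sampling algorithms for lattice gauge theory;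
figures of merit are autocorrelation/cost numbers at stated couplings and volumes; no
continuum-physics claim.

Venture `LatticeQCDFlow` (cell pub-lqcd), topic `Exactness`; FANOUT row 7 (`s0-cpn-null`: the
S0-D1 rung — 2D CP⁹, Lüscher's LO trivializing map inside HMC, Engel–Schaefer 2011).  NEW WORK of
the cell over Mathlib and the tree's `Exactness/FlowPushforward.lean` (`HasJacobian vol F J`:
`F_* (J · vol) = vol`), `Exactness/KickAngleJacobian.lean` (`polarLaw`, `kickJac`,
`hasJacobian_kickAngle_prod`), `Exactness/SphereGeodesicKick.lean` (`geodesicKick`),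
`Exactness/SphereAxisCoordinates.lean` (`polarAxis`, `latitudePt`, `geodesicKick_latitudePt`) and
`Exactness/SphereAxisDisintegration.lean` (`toSphere_eq_map_latitudePt`: the surface measure of
`S^{n+1}` is `latitudePt_* (polarLaw n ⊗ σ_{S^n})`); nothing is cited as a fact.  Printed
counterparts, NAMED ONLY: Engel–Schaefer, Comput. Phys. Commun. 182 (2011) 2107, §3 eqs. (17)–(18);
Lüscher, Commun. Math. Phys. 293 (2010) 899, §3.

This file closes the link that `KickAngleJacobian.lean`, `SphereGeodesicKick.lean` and
`KickAnglePolarTHMC.lean` state as NOT CLAIMED: the one-dimensional Jacobian of the polar-angle map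
against `sin^n θ dθ` (`hasJacobian_kickAngle`), transported through the axis disintegration of the
surface measure, IS the Jacobian of the single-site leading-order update `x ↦ geodesicKick c J x`
against the surface measure of the site sphere — E–S eq. (18) as a theorem about measures on
`S^{n+1}`, for the local field along the axis (`J = r • e₀`; a general direction is one linear
isometry away, `SphereGeodesicKick.geodesicKick_map`).

## Content

* `map_withDensity_comp_eq'`, **`HasJacobian.of_semiconj`** — Jacobians transport along an
  a.e. semiconjugacy `F ∘ Φ = Φ ∘ G` from `ρ` to `Φ_* ρ` (general measure theory);
  `HasJacobian.lintegral_comp_mul` — the change-of-variables identity `∫ q dvol = ∫ (q ∘ F) · J dvol`.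
* `sphereKick c J : S(V) → S(V)` — the E–S site update as a self-map of the unit sphere
  (`norm_geodesicKick`); `sin_div_norm_smul_eq_sinc`, **`continuous_geodesicKick`** (the
  `sin(c‖p‖)/‖p‖` singularity at the poles is removable: `= c · sinc(c‖p‖)`),
  `continuous_sphereKick`, `measurable_sphereKick`; `sphereKick_latitudePt` (in latitude
  coordinates the update is `kickAngle (c r) × id`).
* **`hasJacobian_sphereKick_polarAxis`** — for `r > 0` and `|c r| ≤ 1`:
  `HasJacobian σ_{S^{n+1}} (sphereKick c (r • e₀)) (x ↦ kickJac (c r) n (angle e₀ x))`, i.e.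
  `(sphereKick)_* (kickJac (c r) n (θ(x)) · σ) = σ` with `σ` Mathlib's surface measure
  `volume.toSphere` of `S^{n+1} ⊂ ℝ^{n+2}` and `kickJac κ n θ' = (1 − κ cos θ')(sin θ/sin θ')^n`
  the printed factor of E–S eq. (18) (`n = 2N − 2` for CP(N−1)).
* `lintegral_toSphere_comp_sphereKick` — the same as the integral identity
  `∫ q dσ = ∫ q(kick x) · kickJac (c r) n (θ(x)) dσ(x)` for measurable `q ≥ 0`;
  `map_sphereKick_withDensity` — the model-density form: a weight `(p ∘ kick) · kickJac` is pushed
  by the kick to the weight `p` (what makes the field-transformed update exact,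
  `TransformedKernel.transformedUpdate_invariant`).

NOT CLAIMED: the update as a measurable EQUIVALENCE of the sphere (bijectivity for `|c r| ≤ 1` is
`KickAngleMap.bijOn_kickAngle` plus the fixed azimuth; not assembled here), general field
directions / ambient inner product spaces (one isometry away), several sites / the sweep
(`CheckerboardSweep.lean`), anything about autocorrelations.
-/

noncomputable section

namespace Summit.Ventures.LatticeQCDFlow.Exactness

open Real Set MeasureTheory Measure InnerProductGeometry Metric
open scoped ENNReal InnerProductSpace

/-! ## §1 Jacobians transport along semiconjugacies -/

section Transport

variable {α Ω : Type*} [MeasurableSpace α] [MeasurableSpace Ω]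

/-- `Φ_* ((g ∘ Φ) · ρ) = g · Φ_* ρ` for a measurable map `Φ : α → Ω` between two spaces (the
two-space form of `FlowPushforward.map_withDensity_comp_eq`). -/
theorem map_withDensity_comp_eq' {ρ : Measure α} {Φ : α → Ω} (hΦ : Measurable Φ)
    {g : Ω → ℝ≥0∞} (hg : Measurable g) :
    (ρ.withDensity fun a => g (Φ a)).map Φ = (ρ.map Φ).withDensity g := by
  ext s hs
  rw [Measure.map_apply hΦ hs, withDensity_apply _ (hΦ hs), withDensity_apply _ hs,
    Measure.restrict_map hΦ hs, lintegral_map hg hΦ]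

/-- **Jacobians transport along a semiconjugacy.**  Let `Φ : α → Ω` be measurable, let `G` have
Jacobian `j'` with respect to `ρ` on `α`, and let `F : Ω → Ω` (measurable) and `j : Ω → ℝ≥0∞`
(measurable) satisfy `F ∘ Φ = Φ ∘ G` and `j ∘ Φ = j'` `ρ`-almost everywhere.  Then `F` has
Jacobian `j` with respect to `Φ_* ρ`.  (Coordinates: `Φ` = the latitude map, `G = kickAngle × id`.) -/
theorem HasJacobian.of_semiconj {ρ : Measure α} {Φ : α → Ω} (hΦ : Measurable Φ) {G : α → α}
    {j' : α → ℝ≥0∞} (hG : HasJacobian ρ G j') {F : Ω → Ω} (hF : Measurable F) {j : Ω → ℝ≥0∞}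
    (hj : Measurable j) (hconj : (fun a => F (Φ a)) =ᵐ[ρ] fun a => Φ (G a))
    (hjac : (fun a => j (Φ a)) =ᵐ[ρ] j') : HasJacobian (ρ.map Φ) F j where
  measurable := hF
  measurable_jac := hj
  map_eq := by
    have hconj' : F ∘ Φ =ᵐ[ρ.withDensity j'] Φ ∘ G :=
      hconj.filter_mono (withDensity_absolutelyContinuous ρ j').ae_le
    rw [← map_withDensity_comp_eq' hΦ hj, withDensity_congr_ae hjac, Measure.map_map hF hΦ,
      Measure.map_congr hconj', ← Measure.map_map hΦ hG.measurable, hG.map_eq]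

/-- **Change of variables from a Jacobian**: if `F` has Jacobian `J` w.r.t. `vol`, then for every
measurable `q ≥ 0`, `∫ q dvol = ∫ q(F x) · J(x) dvol(x)`. -/
theorem HasJacobian.lintegral_comp_mul {vol : Measure Ω} {F : Ω → Ω} {J : Ω → ℝ≥0∞}
    (h : HasJacobian vol F J) {q : Ω → ℝ≥0∞} (hq : Measurable q) :
    ∫⁻ x, q x ∂vol = ∫⁻ x, q (F x) * J x ∂vol := by
  have hqF : Measurable fun x => q (F x) := hq.comp h.measurable
  conv_lhs => rw [← h.map_eq]
  rw [lintegral_map hq h.measurable, lintegral_withDensity_eq_lintegral_mul _ h.measurable_jac hqF]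
  exact lintegral_congr fun x => mul_comm _ _

end Transport

/-! ## §2 The site update as a self-map of the unit sphere -/

section Kick

variable {V : Type*} [NormedAddCommGroup V] [InnerProductSpace ℝ V]

/-- **The Engel–Schaefer single-site LO update as a map of the unit sphere to itself**
(`SphereGeodesicKick.norm_geodesicKick`): `x ↦ geodesicKick c J x`. -/
def sphereKick (c : ℝ) (J : V) (x : sphere (0 : V) 1) : sphere (0 : V) 1 :=
  ⟨geodesicKick c J x, mem_sphere_zero_iff_norm.2 (norm_geodesicKick c J (norm_eq_of_mem_sphere x))⟩

/-- The update in vector form. -/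
@[simp] theorem coe_sphereKick (c : ℝ) (J : V) (x : sphere (0 : V) 1) :
    (sphereKick c J x : V) = geodesicKick c J x := rfl

/-- The removable singularity of E–S eq. (17): `(sin (c‖p‖) / ‖p‖) • p = (c · sinc (c‖p‖)) • p`
for every `p` (both sides vanish at `p = 0`). -/
theorem sin_div_norm_smul_eq_sinc (c : ℝ) (p : V) :
    (sin (c * ‖p‖) / ‖p‖) • p = (c * sinc (c * ‖p‖)) • p := by
  rcases eq_or_ne p 0 with hp | hp
  · rw [hp, smul_zero, smul_zero]
  · have hn : ‖p‖ ≠ 0 := norm_ne_zero_iff.2 hp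
    rcases eq_or_ne c 0 with hc | hc
    · simp [hc]
    · congr 1
      rw [sinc_of_ne_zero (mul_ne_zero hc hn)]
      field_simp

/-- The tangential part of the local field depends continuously on the site variable. -/
theorem continuous_tangentKick (J : V) : Continuous (tangentKick J) := by
  unfold tangentKick
  exact continuous_const.sub ((continuous_const.inner continuous_id).smul continuous_id)

/-- **The LO site update is continuous** on the whole space (the `sin(c‖p‖)/‖p‖` factor has a
removable singularity where the tangential field vanishes, i.e. at the two poles `x = ±Ĵ`). -/
theorem continuous_geodesicKick (c : ℝ) (J : V) : Continuous (geodesicKick c J) := by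
  have hp := continuous_tangentKick J
  have hn : Continuous fun x => c * ‖tangentKick J x‖ := continuous_const.mul (continuous_norm.comp hp)
  have h : geodesicKick c J = fun x => cos (c * ‖tangentKick J x‖) • x +
      (c * sinc (c * ‖tangentKick J x‖)) • tangentKick J x := by
    funext x
    rw [geodesicKick, sin_div_norm_smul_eq_sinc]
  rw [h]
  exact ((continuous_cos.comp hn).smul continuous_id).add
    ((continuous_const.mul (continuous_sinc.comp hn)).smul hp)

/-- The update is continuous as a self-map of the sphere. -/
theorem continuous_sphereKick (c : ℝ) (J : V) : Continuous (sphereKick c J) :=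
  ((continuous_geodesicKick c J).comp continuous_subtype_val).subtype_mk _

variable [MeasurableSpace V] [BorelSpace V]

/-- The update is measurable as a self-map of the sphere. -/
theorem measurable_sphereKick (c : ℝ) (J : V) : Measurable (sphereKick c J) :=
  (continuous_sphereKick c J).measurable

end Kick

/-! ## §3 E–S eq. (18) as a `HasJacobian` against the surface measure -/

variable (n : ℕ)

/-- In latitude coordinates the update with field `r • e₀` is `kickAngle (c r) × id` (as points of
the sphere; `SphereAxisCoordinates.geodesicKick_latitudePt`). -/
theorem sphereKick_latitudePt (c : ℝ) {r : ℝ} (hr : 0 < r) {θ : ℝ} (hθ : θ ∈ Ioo 0 π)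
    (w : sphere (0 : EuclideanSpace ℝ (Fin (n + 1))) 1) :
    sphereKick c (r • polarAxis n) (latitudePt n θ w) = latitudePt n (kickAngle (c * r) θ) w :=
  Subtype.ext (geodesicKick_latitudePt n c hr hθ w)

/-- The printed Jacobian, read through the polar angle from the axis, is a measurable function on
the sphere. -/
theorem measurable_kickJac_angle (κ : ℝ) :
    Measurable fun x : sphere (0 : EuclideanSpace ℝ (Fin (n + 2))) 1 =>
      ENNReal.ofReal (kickJac κ n (angle (polarAxis n) (x : EuclideanSpace ℝ (Fin (n + 2))))) :=
  ENNReal.measurable_ofReal.comp ((measurable_kickJac κ n).comp (measurable_angle_polarAxis n))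

/-- **Engel–Schaefer eq. (18) on the sphere.**  For the local field along the axis, `J = r • e₀`
with `r > 0`, and a step constant `c` with `|c r| ≤ 1` (the bijectivity range of the polar map,
`KickAngleMap.lean`), the single-site leading-order update `sphereKick c J` of the site sphere
`S^{n+1} ⊂ ℝ^{n+2}` has, with respect to Mathlib's surface measure `volume.toSphere`, the exact
Jacobian `x ↦ kickJac (c r) n (angle e₀ x) = (1 − κ cos θ')(sin θ / sin θ')^n` (`κ = c r`,
`θ' = angle e₀ x`, `θ = kickAngle κ θ'`): `(sphereKick c J)_* (kickJac · σ) = σ`.  Proof: the axis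
disintegration `σ = latitudePt_* (polarLaw n ⊗ σ_{S^n})`, the one-dimensional Jacobian
`hasJacobian_kickAngle_prod`, and transport along the semiconjugacy
`sphereKick ∘ latitudePt = latitudePt ∘ (kickAngle κ × id)` (off the two poles, a null set). -/
theorem hasJacobian_sphereKick_polarAxis {c r : ℝ} (hr : 0 < r) (hκ : |c * r| ≤ 1) :
    HasJacobian (volume : Measure (EuclideanSpace ℝ (Fin (n + 2)))).toSphere
      (sphereKick c (r • polarAxis n))
      fun x => ENNReal.ofReal (kickJac (c * r) n (angle (polarAxis n)
        (x : EuclideanSpace ℝ (Fin (n + 2))))) := by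
  haveI : SFinite (polarLaw n) := by unfold polarLaw; infer_instance
  rw [toSphere_eq_map_latitudePt n]
  refine HasJacobian.of_semiconj (measurable_latitudePt n)
    (hasJacobian_kickAngle_prod hκ n (volume : Measure (EuclideanSpace ℝ (Fin (n + 1)))).toSphere)
    (measurable_sphereKick c _) (measurable_kickJac_angle n (c * r)) ?_ ?_
  · filter_upwards [quasiMeasurePreserving_fst.ae (ae_polarLaw_mem_Ioo n)] with p hp
    rw [sphereKick_latitudePt n c hr hp p.2]
    rfl
  · filter_upwards [quasiMeasurePreserving_fst.ae (ae_polarLaw_mem_Icc n)] with p hp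
    simp only [angle_polarAxis_latitudePt n hp p.2]

/-- **E–S eq. (18) as an integral identity on the site sphere**: for every measurable `q ≥ 0` on
`S^{n+1}`, `∫ q dσ = ∫ q(sphereKick c J x) · kickJac (c r) n (angle e₀ x) dσ(x)` (`J = r • e₀`,
`r > 0`, `|c r| ≤ 1`) — expectations under the surface measure are computed in the pre-image
variable with the printed factor as weight. -/
theorem lintegral_toSphere_comp_sphereKick {c r : ℝ} (hr : 0 < r) (hκ : |c * r| ≤ 1)
    {q : sphere (0 : EuclideanSpace ℝ (Fin (n + 2))) 1 → ℝ≥0∞} (hq : Measurable q) :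
    ∫⁻ x, q x ∂(volume : Measure (EuclideanSpace ℝ (Fin (n + 2)))).toSphere =
      ∫⁻ x, q (sphereKick c (r • polarAxis n) x) *
        ENNReal.ofReal (kickJac (c * r) n (angle (polarAxis n) (x : EuclideanSpace ℝ (Fin (n + 2)))))
        ∂(volume : Measure (EuclideanSpace ℝ (Fin (n + 2)))).toSphere :=
  (hasJacobian_sphereKick_polarAxis n hr hκ).lintegral_comp_mul hq

/-- **Model-density form** (what makes the field-transformed update exact,
`TransformedKernel.transformedUpdate_invariant` / `FlowPushforward.HasJacobian.map_withDensity`):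
for every measurable weight `p ≥ 0` on the site sphere, the update pushes the weight
`(p ∘ sphereKick) · kickJac` forward to the weight `p`:
`(sphereKick c J)_* (((p ∘ sphereKick c J) · kickJac) · σ) = p · σ`. -/
theorem map_sphereKick_withDensity {c r : ℝ} (hr : 0 < r) (hκ : |c * r| ≤ 1)
    {p : sphere (0 : EuclideanSpace ℝ (Fin (n + 2))) 1 → ℝ≥0∞} (hp : Measurable p) :
    ((volume : Measure (EuclideanSpace ℝ (Fin (n + 2)))).toSphere.withDensity fun x =>
        p (sphereKick c (r • polarAxis n) x) *
          ENNReal.ofReal (kickJac (c * r) n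
            (angle (polarAxis n) (x : EuclideanSpace ℝ (Fin (n + 2)))))).map
        (sphereKick c (r • polarAxis n)) =
      (volume : Measure (EuclideanSpace ℝ (Fin (n + 2)))).toSphere.withDensity p :=
  (hasJacobian_sphereKick_polarAxis n hr hκ).map_withDensity hp

end Summit.Ventures.LatticeQCDFlow.Exactness

end
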